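import Literature.MathematicalPhysics.QuantumFieldTheory.Balaban1983to89.B8Eq119TwistedAxialRec
import Literature.MathematicalPhysics.QuantumFieldTheory.Balaban1983to89.B8Eq138LandauZd

/-!
# `Balaban1983to89.B8Eq138LandauZdRec` — [Balaban1985RegularSpaces] (1.38)∕(1.42) «R(U₀)D^{η*}_{U₀}A = 0» and (1.146) «R(U₀)D^{η*}_{U₀}A = f» in the engine's
# Lagrange-multiplier form, TYPED FOR THE RECORD's symmetric block averaging [Balaban1987RG1] (0.4): the transpose stencils of the linearised record
# averaging over the CENTRED blocking (`qprimeT1Z ∕ QprimeTZ ∕ QTZ`), `InR138Z`, `IsLandau138Z ∕ 146Z ∕ 138WZ ∕ 146WZ`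

statement-level skeleton of published theorems with citation tags; proofs where landed; nothing here is a claim about the Yang–Mills mass gap

CITATION HEADER.  [6] = T. Bałaban, *Spaces of regular gauge field configurations on a lattice and gauge fixing conditions*, Commun. Math. Phys. **99**
(1985) 75–102 [Balaban1985RegularSpaces]: p. 80 (1.27), p. 82 (1.38) *«R(U₀)D^{η*}_{U₀}A = 0»*, p. 101 (1.146) *«R(U₀)D^{η*}_{U₀}A = f, where f is a function from the
space R(U₀)»*; [4] = [Balaban1985BackgroundPropagators] (3.19) p. 393 (`Q′_j(U) = Q′(Ūʲ⁻¹)⋯Q′(U)`), (3.21)–(3.25) p. 394; [I] = [Balaban1987RG1] (0.3)–(0.4) pp. 252–253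
(the averaging of record: CENTRED blocks).
Cell `pub-ymgap`, seat `pub-ymgap-dag-n05-d` g23 — «N05-REC» road, item R2 (LEAD PEN dag-n05-e; word I.45179 (q1)).  Twin of `B8Eq138LandauZd` (dag-n05-a g4): the three structure-free
stencils `covDivB`, `covLap`, `logCfg` are REUSED by name; what changes is the BLOCKING of the transpose stencil (`qprimeT1`: the block of `x` is the CENTRED
block, block map `B8Ineq130Rec.fl` = `⌊(x + s𝟙)∕L⌋` in place of `QuantumLattice.blockMap` = `⌊x∕L⌋`) and the transporters (`bgT ↦ bgTZ`, the record averages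
`avgIterZ` along the contours from the centre) — TOKEN RULE (T1)∕(T2); `InR138Z` reads `QprimeIter (zdBlockingZ d L) (bgTZ L U₀)` (dag-n05-e's R0b-2).
`--kind definition --supports stmt-QuantumFields-20541` (K0⁷; count-neutral).

WHAT IS DEFINED ∕ PROVED (sorry-free).  §1 `qprimeT1Z`, `QprimeTZ`, `QTZ`; §2 `InR138Z`, `IsLandau138Z`, `IsLandau146Z`, `IsLandau138WZ`, `IsLandau146WZ` (verbatim twins);
§3 API: `qprimeT1Z_zero`, `QprimeTZ_zero`, `QTZ_zero`, `inR138Z_zero`, `isLandau138Z_zero`, `isLandau138WZ_one`, `isLandau146Z_zero_iff`, `isLandau146WZ_zero_iff`,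
`indicator_covDivB_sub_congr`, `isLandau138Z_congr`, `isLandau146Z_congr`, `isLandau138WZ_congr`, `isLandau146WZ_congr` (LOCAL forms: agreement on the bonds touching Ω₀,
as the engine's `isLandau138_congr` — asked by dag-n05-c for the R5 sockets).
HONEST SCOPE.  Definitions + bookkeeping (as the engine module: the identification of the multiplier form with print's projection R(U₀) is `B8Eq138Multiplier`'s,
modulo [4] Thm 3.11, untouched here); nothing of [4]∕[6]∕[I] asserted; `HThm4Rec` UNDISCHARGED; N05 ∕ N07 NOT discharged; counts unmoved; one finite 𝕋⁴ programme at
fixed ε — nothing continuum ∕ ℝ⁴ ∕ OS ∕ mass gap ∕ Clay.  No `instance`, no `notation`, no `sorry`.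
-/

noncomputable section

open scoped BigOperators ComplexConjugate

namespace Literature.MathematicalPhysics.QuantumFieldTheory.Balaban1983to89.B8Eq138LandauZdRec

open MatrixLog B7Prop1Explicit B7Eq78Linearization BlockAveragingZd B8Ineq130Rec
open B7SectEFLinearisationRec (zdBlockingZ bgTZ bgTZ_apply)
open B8Eq119TwistedAxialRec (bgTZ_one)
open B8Ineq132 (covDeriv covDerivFwd)
open B8Eq138LandauZd (covDivB covLap logCfg covDivB_zero covLap_zero logCfg_one covDivB_congr logCfg_congr)
open Complex (I)

-- `Site` alone could resolve to the torus sites of `Setup.lean`; re-export the `ℤ^d` sites of `B7Prop1Explicit`.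
export B7Prop1Explicit (Site)

variable {d : ℕ}
variable {𝔸 : Type*} [NormedRing 𝔸] [NormedAlgebra ℂ 𝔸] [CompleteSpace 𝔸]

/-! ## §1  The transpose stencil `Q′(U₀)ᵀ` of the linearised RECORD averaging (centred blocks, transporters from the centre) -/

section Stencils

/-- **One step of the transpose stencil, RECORD blocking**: the step `j ↦ j+1` of `QprimeIter (zdBlockingZ d L) (bgTZ L U₀)` is `(Q′ν)(y) = Σ_{x ∈ B(y)} L⁻ᵈ R(T_j(y, x))ν(x)`
over the CENTRED block `B(y) = L•y + [−s,s]ᵈ`; its transpose sends a level-`(j+1)` function `ν` to `x ↦ L⁻ᵈ · R(T_j(y, x))⁻¹ ν(y)` with `y = fl L x` the coarse site whose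
centred block contains `x` (engine: `blockMap L x`, corner blocks). [cite: Balaban1985BackgroundPropagators, (3.19) p.393; Balaban1985RegularSpaces, (1.29) p.81; Balaban1987RG1, (0.3) p.252] -/
def qprimeT1Z (L : ℕ) (U₀ : Site d → Fin d → 𝔸ˣ) (j : ℕ) (ν : Site d → 𝔸) (x : Site d) : 𝔸 :=
  (((L : ℝ) ^ d)⁻¹) • conjR (bgTZ L U₀ j (fl L x) x)⁻¹ (ν (fl L x))

/-- **`Q′_j(U₀)ᵀ`, RECORD blocking** — the one-step transposes composed in reverse order (twin of `B8Eq138LandauZd.QprimeT`). [cite: Balaban1985BackgroundPropagators, (3.19) p.393] -/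
def QprimeTZ (L : ℕ) (U₀ : Site d → Fin d → 𝔸ˣ) : ℕ → (Site d → 𝔸) → Site d → 𝔸
  | 0, ν => ν
  | j + 1, ν => QprimeTZ L U₀ j (qprimeT1Z L U₀ j ν)

/-- **`Q′(U₀)ᵀμ` for a multiplier on `𝔅_m = ⋃_{j ≤ m} Λ_j`**, RECORD blocking (twin of `B8Eq138LandauZd.QT`). [cite: Balaban1985BackgroundPropagators, (3.24) p.394; Balaban1985RegularSpaces, (1.29) p.81] -/
def QTZ (L m : ℕ) (Λs : ℕ → Set (Site d)) (U₀ : Site d → Fin d → 𝔸ˣ) (μ : ℕ → Site d → 𝔸) (x : Site d) : 𝔸 :=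
  ∑ j ∈ Finset.range (m + 1), QprimeTZ L U₀ j ((Λs j).indicator (μ j)) x

end Stencils

/-! ## §2  The Landau conditions (1.38)∕(1.146) in multiplier form, RECORD blocking -/

section Landau

/-- **«f is a function from the space R(U₀)»** (p. 101), R(U₀) = Δ^η_{U₀}N(Q′(U₀)) with the RECORD's iterated linearised averaging
`QprimeIter (zdBlockingZ d L) (bgTZ L U₀)` (twin of `B8Eq138LandauZd.InR138`). [cite: Balaban1985RegularSpaces, (1.146) p.101; Balaban1985BackgroundPropagators, (3.21) p.394] -/
def InR138Z (L m : ℕ) (η : ℝ) (Ω₀ : Set (Site d)) (Λs : ℕ → Set (Site d)) (U₀ : Site d → Fin d → 𝔸ˣ)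
    (f : Site d → 𝔸) : Prop :=
  ∃ lam : Site d → 𝔸,
    (∀ j, j ≤ m → ∀ y ∈ Λs j, QprimeIter (zdBlockingZ d L) (bgTZ L U₀) j (Ω₀.indicator lam) y = 0) ∧
      ∀ x ∈ Ω₀, f x = covLap η U₀ (Ω₀.indicator lam) x

/-- **(1.38)∕(1.42) «R(U₀)D^{η*}_{U₀}A = 0» IN MULTIPLIER FORM, RECORD blocking**: there is a multiplier `μ` on `𝔅_m` with `Δ^η_{U₀}↾Ω₀(D^{η*}_{U₀}A) = Q′(U₀)ᵀμ` at every
site of Ω₀ (twin of `B8Eq138LandauZd.IsLandau138`). [cite: Balaban1985RegularSpaces, (1.38) p.82; Balaban1985BackgroundPropagators, (3.25) p.394] -/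
def IsLandau138Z (L m : ℕ) (η : ℝ) (Ω₀ : Set (Site d)) (Λs : ℕ → Set (Site d)) (U₀ : Site d → Fin d → 𝔸ˣ)
    (A : Site d → Fin d → 𝔸) : Prop :=
  ∃ μ : ℕ → Site d → 𝔸, ∀ x ∈ Ω₀, covLap η U₀ (Ω₀.indicator (covDivB η U₀ A)) x = QTZ L m Λs U₀ μ x

/-- **(1.146) «R(U₀)D^{η*}_{U₀}A = f, R(U₀)f = f» IN MULTIPLIER FORM, RECORD blocking** (twin of `B8Eq138LandauZd.IsLandau146`).
[cite: Balaban1985RegularSpaces, (1.146) p.101] -/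
def IsLandau146Z (L m : ℕ) (η : ℝ) (Ω₀ : Set (Site d)) (Λs : ℕ → Set (Site d)) (U₀ : Site d → Fin d → 𝔸ˣ)
    (f : Site d → 𝔸) (A : Site d → Fin d → 𝔸) : Prop :=
  InR138Z L m η Ω₀ Λs U₀ f ∧
    ∃ μ : ℕ → Site d → 𝔸, ∀ x ∈ Ω₀, covLap η U₀ (Ω₀.indicator (covDivB η U₀ A - f)) x = QTZ L m Λs U₀ μ x

/-- **(1.38) for a configuration `W = e^{iηA}`**, RECORD blocking (twin of `B8Eq138LandauZd.IsLandau138W` — the `Lan m W` slot of the Theorem-4 knit).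
[cite: Balaban1985RegularSpaces, (1.36)–(1.38) p.82] -/
def IsLandau138WZ (L m : ℕ) (η : ℝ) (Ω₀ : Set (Site d)) (Λs : ℕ → Set (Site d))
    (U₀ W : Site d → Fin d → 𝔸ˣ) : Prop :=
  IsLandau138Z L m η Ω₀ Λs U₀ (logCfg η W)

/-- **(1.146) for a configuration `W`**, RECORD blocking (twin of `B8Eq138LandauZd.IsLandau146W`). [cite: Balaban1985RegularSpaces, (1.146) p.101] -/
def IsLandau146WZ (L m : ℕ) (η : ℝ) (Ω₀ : Set (Site d)) (Λs : ℕ → Set (Site d)) (U₀ : Site d → Fin d → 𝔸ˣ)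
    (f : Site d → 𝔸) (W : Site d → Fin d → 𝔸ˣ) : Prop :=
  IsLandau146Z L m η Ω₀ Λs U₀ f (logCfg η W)

end Landau

/-! ## §3  API: the zero ∕ unit cases (non-vacuity) and locality -/

section API

variable (η : ℝ) (L : ℕ) (U₀ : Site d → Fin d → 𝔸ˣ)

/-- `(step j)ᵀ 0 = 0`. [cite: Balaban1985BackgroundPropagators, (3.19) p.393 (bookkeeping)] -/
theorem qprimeT1Z_zero (j : ℕ) (x : Site d) : qprimeT1Z L U₀ j (0 : Site d → 𝔸) x = 0 := by
  simp [qprimeT1Z, conjR_apply]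

/-- `Q′_jᵀ 0 = 0`. [cite: Balaban1985BackgroundPropagators, (3.19) p.393 (bookkeeping)] -/
theorem QprimeTZ_zero : ∀ (j : ℕ) (x : Site d), QprimeTZ L U₀ j (0 : Site d → 𝔸) x = 0 := by
  intro j
  induction j with
  | zero => intro x; rfl
  | succ j ih =>
    intro x
    have h0 : qprimeT1Z L U₀ j (0 : Site d → 𝔸) = 0 := funext (qprimeT1Z_zero L U₀ j)
    show QprimeTZ L U₀ j (qprimeT1Z L U₀ j 0) x = 0
    rw [h0, ih]

/-- `Q′ᵀ 0 = 0` (the zero multiplier). [cite: Balaban1985BackgroundPropagators, (3.24) p.394 (bookkeeping)] -/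
theorem QTZ_zero (m : ℕ) (Λs : ℕ → Set (Site d)) (x : Site d) : QTZ L m Λs U₀ (fun _ _ => (0 : 𝔸)) x = 0 := by
  unfold QTZ
  refine Finset.sum_eq_zero fun j _ => ?_
  have : (Λs j).indicator (fun _ : Site d => (0 : 𝔸)) = 0 := by funext y; simp
  rw [this, QprimeTZ_zero]

/-- `Q′_j(U₀) 0 = 0` for the RECORD blocking (linearity, `B7Eq78Linearization.QprimeIter_smul` at `c = 0`). [cite: Balaban1985BackgroundPropagators, (3.19) p.393 (bookkeeping)] -/
theorem QprimeIterZ_zero_fun (j : ℕ) (y : Site d) :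
    QprimeIter (zdBlockingZ d L) (bgTZ L U₀) j (fun _ => (0 : 𝔸)) y = 0 := by
  have h := QprimeIter_smul (zdBlockingZ d L) (bgTZ L U₀) (0 : ℂ) (fun _ : Site d => (0 : 𝔸)) j
  simp only [zero_smul] at h
  exact congrFun h y

/-- `0 ∈ R(U₀)` (with `λ = 0`), RECORD blocking. [cite: Balaban1985RegularSpaces, (1.146) p.101 (bookkeeping)] -/
theorem inR138Z_zero (m : ℕ) (Ω₀ : Set (Site d)) (Λs : ℕ → Set (Site d)) : InR138Z L m η Ω₀ Λs U₀ (0 : Site d → 𝔸) := by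
  refine ⟨fun _ => 0, fun j _ y _ => ?_, fun x _ => ?_⟩
  · have h : Ω₀.indicator (fun _ : Site d => (0 : 𝔸)) = fun _ => 0 := by funext z; simp
    rw [h]
    exact QprimeIterZ_zero_fun L U₀ j y
  · have h : Ω₀.indicator (fun _ : Site d => (0 : 𝔸)) = 0 := by funext z; simp
    rw [h, covLap_zero]
    rfl

/-- **Non-vacuity**: `A = 0` satisfies (1.38) (multiplier `0`), RECORD blocking. [cite: Balaban1985RegularSpaces, (1.38) p.82 (bookkeeping)] -/
theorem isLandau138Z_zero (m : ℕ) (Ω₀ : Set (Site d)) (Λs : ℕ → Set (Site d)) :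
    IsLandau138Z L m η Ω₀ Λs U₀ (0 : Site d → Fin d → 𝔸) := by
  refine ⟨fun _ _ => 0, fun x _ => ?_⟩
  have h0 : covDivB η U₀ (0 : Site d → Fin d → 𝔸) = fun _ => 0 := funext (covDivB_zero η U₀)
  have h1 : Ω₀.indicator (fun _ : Site d => (0 : 𝔸)) = 0 := by funext y; simp
  rw [h0, h1, covLap_zero, QTZ_zero]

/-- **Non-vacuity**: the configuration `W = 1` satisfies (1.38) (`log 1 = 0`), RECORD blocking. [cite: Balaban1985RegularSpaces, (1.38) p.82 (bookkeeping)] -/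
theorem isLandau138WZ_one (m : ℕ) (Ω₀ : Set (Site d)) (Λs : ℕ → Set (Site d)) :
    IsLandau138WZ L m η Ω₀ Λs U₀ (1 : Site d → Fin d → 𝔸ˣ) := by
  unfold IsLandau138WZ
  rw [logCfg_one]
  exact isLandau138Z_zero η L U₀ m Ω₀ Λs

/-- (1.146) with source `f = 0` is (1.38). [cite: Balaban1985RegularSpaces, (1.38) p.82, (1.146) p.101] -/
theorem isLandau146Z_zero_iff (m : ℕ) (Ω₀ : Set (Site d)) (Λs : ℕ → Set (Site d)) (A : Site d → Fin d → 𝔸) :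
    IsLandau146Z L m η Ω₀ Λs U₀ (0 : Site d → 𝔸) A ↔ IsLandau138Z L m η Ω₀ Λs U₀ A := by
  constructor
  · rintro ⟨-, μ, hμ⟩
    exact ⟨μ, fun x hx => by simpa using hμ x hx⟩
  · rintro ⟨μ, hμ⟩
    exact ⟨inR138Z_zero η L U₀ m Ω₀ Λs, μ, fun x hx => by simpa using hμ x hx⟩

/-- (1.146) with source `0` for a configuration is (1.38) for it. [cite: Balaban1985RegularSpaces, (1.38) p.82, (1.146) p.101] -/
theorem isLandau146WZ_zero_iff (m : ℕ) (Ω₀ : Set (Site d)) (Λs : ℕ → Set (Site d)) (W : Site d → Fin d → 𝔸ˣ) :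
    IsLandau146WZ L m η Ω₀ Λs U₀ (0 : Site d → 𝔸) W ↔ IsLandau138WZ L m η Ω₀ Λs U₀ W :=
  isLandau146Z_zero_iff η L U₀ m Ω₀ Λs (logCfg η W)

variable {η L U₀}

omit [CompleteSpace 𝔸] in
/-- Pointwise agreement of the sources `𝟙_{Ω₀}·(D^{η*}_{U₀}A − f)` for two fields agreeing on the bonds touching Ω₀ (the engine's `covDivB_congr`, bond by bond).
[cite: Balaban1985RegularSpaces, (1.38) p.82 (bookkeeping)] -/
theorem indicator_covDivB_sub_congr {Ω₀ : Set (Site d)} (f : Site d → 𝔸) {A A' : Site d → Fin d → 𝔸}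
    (h : ∀ (x : Site d) (μ : Fin d), B8Ineq132.BondTouches Ω₀ x μ → A x μ = A' x μ) :
    Ω₀.indicator (covDivB η U₀ A - f) = Ω₀.indicator (covDivB η U₀ A' - f) := by
  funext x
  by_cases hx : x ∈ Ω₀
  · rw [Set.indicator_of_mem hx, Set.indicator_of_mem hx, Pi.sub_apply, Pi.sub_apply]
    congr 1
    refine B8Eq138LandauZd.covDivB_congr η U₀ fun μ => ⟨h _ _ (Or.inr ?_), h _ _ (Or.inl hx)⟩
    rwa [sub_add_cancel]
  · rw [Set.indicator_of_notMem hx, Set.indicator_of_notMem hx]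

/-- **LOCALITY of (1.38)** (the engine's `isLandau138_congr`, local form asked by dag-n05-c for the R5 sockets): (1.38) reads `A` only through `D^{η*}_{U₀}A` on Ω₀, so two
fields agreeing on the bonds TOUCHING Ω₀ satisfy it simultaneously. [cite: Balaban1985RegularSpaces, (1.38) p.82 (bookkeeping)] -/
theorem isLandau138Z_congr {m : ℕ} {Ω₀ : Set (Site d)} {Λs : ℕ → Set (Site d)} {A A' : Site d → Fin d → 𝔸}
    (h : ∀ (x : Site d) (μ : Fin d), B8Ineq132.BondTouches Ω₀ x μ → A x μ = A' x μ) :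
    IsLandau138Z L m η Ω₀ Λs U₀ A ↔ IsLandau138Z L m η Ω₀ Λs U₀ A' := by
  have hind : Ω₀.indicator (covDivB η U₀ A) = Ω₀.indicator (covDivB η U₀ A') := by
    simpa using indicator_covDivB_sub_congr (η := η) (U₀ := U₀) (0 : Site d → 𝔸) h
  unfold IsLandau138Z
  rw [hind]

/-- **LOCALITY of (1.146)** (local form). [cite: Balaban1985RegularSpaces, (1.146) p.101 (bookkeeping)] -/
theorem isLandau146Z_congr {m : ℕ} {Ω₀ : Set (Site d)} {Λs : ℕ → Set (Site d)} (f : Site d → 𝔸) {A A' : Site d → Fin d → 𝔸}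
    (h : ∀ (x : Site d) (μ : Fin d), B8Ineq132.BondTouches Ω₀ x μ → A x μ = A' x μ) :
    IsLandau146Z L m η Ω₀ Λs U₀ f A ↔ IsLandau146Z L m η Ω₀ Λs U₀ f A' := by
  unfold IsLandau146Z
  rw [indicator_covDivB_sub_congr (η := η) (U₀ := U₀) f h]

/-- **LOCALITY of (1.38) for configurations** (local form: `W = W′` on the bonds touching Ω₀). [cite: Balaban1985RegularSpaces, (1.38) p.82 (bookkeeping)] -/
theorem isLandau138WZ_congr {m : ℕ} {Ω₀ : Set (Site d)} {Λs : ℕ → Set (Site d)} {W W' : Site d → Fin d → 𝔸ˣ}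
    (h : ∀ (x : Site d) (μ : Fin d), B8Ineq132.BondTouches Ω₀ x μ → W x μ = W' x μ) :
    IsLandau138WZ L m η Ω₀ Λs U₀ W ↔ IsLandau138WZ L m η Ω₀ Λs U₀ W' :=
  isLandau138Z_congr fun x μ hb => B8Eq138LandauZd.logCfg_congr η (h x μ hb)

/-- **LOCALITY of (1.146) for configurations** (local form). [cite: Balaban1985RegularSpaces, (1.146) p.101 (bookkeeping)] -/
theorem isLandau146WZ_congr {m : ℕ} {Ω₀ : Set (Site d)} {Λs : ℕ → Set (Site d)} (f : Site d → 𝔸) {W W' : Site d → Fin d → 𝔸ˣ}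
    (h : ∀ (x : Site d) (μ : Fin d), B8Ineq132.BondTouches Ω₀ x μ → W x μ = W' x μ) :
    IsLandau146WZ L m η Ω₀ Λs U₀ f W ↔ IsLandau146WZ L m η Ω₀ Λs U₀ f W' :=
  isLandau146Z_congr f fun x μ hb => B8Eq138LandauZd.logCfg_congr η (h x μ hb)

end API

end Literature.MathematicalPhysics.QuantumFieldTheory.Balaban1983to89.B8Eq138LandauZdRec
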